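import Mathlib

/-!
# A counting lemma on ±1 sequences of length 23 with periodic autocorrelation ≡ −1 (mod 7) (kernel, general)

Framing: lottery ticket; floor = certified bounds/negative ranges.

Cell pub-namedobj (venture DiscreteObjects), target (H), hadamard gen 11 — the 'PAF lemma' of FAMILY-F12-G10 §8(m), proved by
COUNTING (no enumeration of `2²³` sign vectors).  Let `γ` act on a `23`-set `Ω` as a `23`-cycle (every point's `γ`-orbit,
indexed by `s < 23`, is `Ω`) and let `c : Ω → {±1}` satisfy `7 ∣ 1 + PAF_c(s)` for `s = 1, …, 22`, where
`PAF_c(s) = ∑_{x ∈ Ω} c(x) c(γ^s x)`.  Then `∑_{x ∈ Ω} c(x) = ±1` (`paf23_sum_eq_pm_one`).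
Proof: with `a = (1 − c)/2 ∈ {0,1}`, `w = ∑ a`, `m(s) = ∑_x a(x) a(γ^s x)`: `PAF(s) = 23 − 4w + 4 m(s)`, so
`m(s) ≡ w − 6 (mod 7)`; with `0 ≤ m(s) ≤ w` this forces `m(s) ≤ w − 6`; and `∑_{s<23} m(s) = w²`, `m(0) = w`, hence
`w² − w ≤ 22 (w − 6)`, i.e. `(w − 11)(w − 12) ≤ 0`, `w ∈ {11, 12}`, `∑ c = 23 − 2w = ±1`.  (In fact `PAF ≡ −1` exactly and the
`−1`-set is a `(23,11,5)` or `(23,12,6)` difference set; not needed.)  Used by `CompositeOrder161`.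
Ours (elementary), not literature; no `sorry`.
-/

namespace Summit.Ventures.DiscreteObjects.Hadamard

open Finset BigOperators

/-- **PAF lemma.**  A `±1` function on a `23`-cycle whose periodic autocorrelations at the `22` nonzero shifts are all
`≡ −1 (mod 7)` has sum `±1`. -/
theorem paf23_sum_eq_pm_one {ι : Type*} [DecidableEq ι] (Ω : Finset ι) (hΩ : Ω.card = 23) (γ : Equiv.Perm ι)
    (hmem : ∀ (s : ℕ), ∀ x ∈ Ω, (γ ^ s) x ∈ Ω)
    (horb : ∀ x ∈ Ω, ∀ f : ι → ℤ, ∑ s ∈ Finset.range 23, f ((γ ^ s) x) = ∑ y ∈ Ω, f y)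
    (hinv : ∀ (s : ℕ) (f : ι → ℤ), ∑ x ∈ Ω, f ((γ ^ s) x) = ∑ x ∈ Ω, f x)
    (c : ι → ℤ) (hc : ∀ x ∈ Ω, c x = 1 ∨ c x = -1)
    (hpaf : ∀ s : ℕ, 0 < s → s < 23 → (7 : ℤ) ∣ 1 + ∑ x ∈ Ω, c x * c ((γ ^ s) x)) :
    ∑ x ∈ Ω, c x = 1 ∨ ∑ x ∈ Ω, c x = -1 := by
  -- the 0/1 indicator of the value -1
  set a : ι → ℤ := fun x => if c x = -1 then 1 else 0 with ha_def
  have ha01 : ∀ x, a x = 0 ∨ a x = 1 := by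
    intro x; simp only [ha_def]; split_ifs <;> simp
  have ha0 : ∀ x, 0 ≤ a x := fun x => by rcases ha01 x with h | h <;> simp [h]
  have ha1 : ∀ x, a x ≤ 1 := fun x => by rcases ha01 x with h | h <;> simp [h]
  have hca : ∀ x ∈ Ω, c x = 1 - 2 * a x := by
    intro x hx
    simp only [ha_def]
    rcases hc x hx with h | h
    · rw [h]; norm_num
    · rw [h]; norm_num
  set w : ℤ := ∑ x ∈ Ω, a x with hw_def
  have hw0 : 0 ≤ w := Finset.sum_nonneg fun x _ => ha0 x
  have hw23 : w ≤ 23 := by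
    calc w = ∑ x ∈ Ω, a x := rfl
      _ ≤ ∑ x ∈ Ω, (1 : ℤ) := Finset.sum_le_sum fun x _ => ha1 x
      _ = 23 := by rw [Finset.sum_const, hΩ]; norm_num
  -- m(s)
  set m : ℕ → ℤ := fun s => ∑ x ∈ Ω, a x * a ((γ ^ s) x) with hm_def
  have hm_le : ∀ s, m s ≤ w := by
    intro s
    show ∑ x ∈ Ω, a x * a ((γ ^ s) x) ≤ ∑ x ∈ Ω, a x
    apply Finset.sum_le_sum
    intro x _
    calc a x * a ((γ ^ s) x) ≤ a x * 1 := mul_le_mul_of_nonneg_left (ha1 _) (ha0 x)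
      _ = a x := mul_one _
  have hm_nonneg : ∀ s, 0 ≤ m s := fun s => Finset.sum_nonneg fun x _ => mul_nonneg (ha0 x) (ha0 _)
  -- PAF(s) = 23 - 4 w + 4 m(s)
  have hpaf_eq : ∀ s, ∑ x ∈ Ω, c x * c ((γ ^ s) x) = 23 - 4 * w + 4 * m s := by
    intro s
    have e : ∀ x ∈ Ω, c x * c ((γ ^ s) x) = 1 - 2 * a x - 2 * a ((γ ^ s) x) + 4 * (a x * a ((γ ^ s) x)) := by
      intro x hx
      rw [hca x hx, hca _ (hmem s x hx)]
      ring
    rw [Finset.sum_congr rfl e, Finset.sum_add_distrib, Finset.sum_sub_distrib, Finset.sum_sub_distrib,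
      Finset.sum_const, hΩ, ← Finset.mul_sum, ← Finset.mul_sum, ← Finset.mul_sum, hinv s a]
    simp only [hw_def, hm_def]
    ring
  -- the congruence and the bound m(s) ≤ w - 6 for s = 1..22
  have hbound : ∀ s, 0 < s → s < 23 → m s ≤ w - 6 := by
    intro s hs0 hs23
    have h7 := hpaf s hs0 hs23
    rw [hpaf_eq s] at h7
    have h1 := hm_le s
    have h2 := hm_nonneg s
    omega
  -- ∑_{s<23} m(s) = w²  and  m(0) = w
  have hsum : ∑ s ∈ Finset.range 23, m s = w * w := by
    show ∑ s ∈ Finset.range 23, ∑ x ∈ Ω, a x * a ((γ ^ s) x) = w * w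
    rw [Finset.sum_comm]
    rw [Finset.sum_congr rfl fun x hx => by rw [← Finset.mul_sum, horb x hx a]]
    rw [← Finset.sum_mul]
  have hm0 : m 0 = w := by
    show ∑ x ∈ Ω, a x * a ((γ ^ 0) x) = w
    rw [pow_zero]
    simp only [Equiv.Perm.coe_one, id_eq]
    apply Finset.sum_congr rfl
    intro x _
    rcases ha01 x with h | h <;> rw [h] <;> norm_num
  -- hence w² - w ≤ 22 (w - 6)
  have hkey : w * w - w ≤ 22 * (w - 6) := by
    have hsplit : ∑ s ∈ Finset.range 23, m s = (∑ i ∈ Finset.range 22, m (i + 1)) + m 0 :=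
      Finset.sum_range_succ' m 22
    have hle : ∑ i ∈ Finset.range 22, m (i + 1) ≤ ∑ i ∈ Finset.range 22, (w - 6) :=
      Finset.sum_le_sum fun i hi => hbound (i + 1) (Nat.succ_pos i)
        (by have := Finset.mem_range.mp hi; omega)
    rw [Finset.sum_const, Finset.card_range] at hle
    rw [hsum, hm0] at hsplit
    have : ∑ i ∈ Finset.range 22, m (i + 1) = w * w - w := by linarith
    rw [this] at hle
    simpa using hle
  -- so w ∈ {11, 12}
  have hw : w = 11 ∨ w = 12 := by
    interval_cases w <;> omega
  -- and ∑ c = 23 - 2 w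
  have hsumc : ∑ x ∈ Ω, c x = 23 - 2 * w := by
    rw [Finset.sum_congr rfl hca, Finset.sum_sub_distrib, Finset.sum_const, hΩ, ← Finset.mul_sum]
    simp [hw_def]
  rcases hw with h | h
  · left; rw [hsumc, h]; norm_num
  · right; rw [hsumc, h]; norm_num

end Summit.Ventures.DiscreteObjects.Hadamard
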